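import Summits.QuantumFields.YangMills.Theorems.AlphaInputsT3ACv3LinearLiftTorus
import HarnessLib

/-!
# `AlphaInputsT3ACv3LinearAvgSup` — STRATEGY B for 2′, (LL)∕(FL) bookkeeping: **`k`-UNIFORM SUP-NORM BOUNDS** for the (0.4)-linear machinery of
# `…v3AbelianEML` ∕ `…v3LinearLiftGauge` ∕ `…v3LinearLiftSpread` — `|M^s a| ≤ L^s·|a|`, the TELESCOPED coboundary potential `Ψ_{s+1}(y) = Ψ_s(y) + Φ(M^s a)(y)` with
# `|Ψ_s| ≤ (d∕2)(L^s − 1)|a|`, hence ★★ `|linAvgIter s a| ≤ (d+1)·L^s·|a|` (constant INDEPENDENT of `s`), and the sup bounds of the spreads `|S0 λ| ≤ 18^d|λ|`,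
# `|S1 A| ≤ 18^d|A|∕L^k` — lane `pub-balaban3d` ∕ cell `ym3-torus`, seat `ym-ust-19936-w1` (g0)

WHY (HOME `ym-ust-19936-w1/NONABELIAN-FL-ARCH-w1-g0.md` §4∕§8; OWNER ruling 2026-08-28T00:06:57Z (iii): the non-abelian (FL) track consumes the (LL) engine by name).  Every
non-abelian use of the linear lift exponentiates `su(2)`-valued one-forms bond by bond, so SUP norms (not only curls) of the iterated linear averages `Q₁^s a = linAvgIter s a` and of
the spread `S1 A` enter the second-order remainders (`…v3EMLSecondOrder`: `O((ℓ·|a|)^2)` per step); `k`-uniformity of the whole scheme needs these norms to grow like `L^s` with an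
`s`-INDEPENDENT constant.  The crude recursion through `Ψ_{s+1} = ptMean Ψ_s + Φ(Q₁^s a)` (`psiIter`) loses a factor `(1 + 2dL)` per level; the point of this file is the exact
cancellation `Φ(Q₁^s a) = Φ(M^s a) − (ptMean Ψ_s − Ψ_s∘emb)` (`stairMean_dgrad`), i.e. **`Ψ_{s+1}(y) = Ψ_s(emb y) + Φ(M^s a)(y)`** (§2), after which everything is geometric.
WHAT IS HERE (no definitions; ℝ-valued, the tree's `wsum`∕`stairMean`∕`segMean`∕`segIter`∕`psiIter`∕`linAvgIter`∕`S0`∕`S1`):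
§1 `abs_wsum_le` (`|wsum a x w| ≤ |w|·M`), `abs_mean_le`, `abs_stairSum_le`, `abs_stairMean_le` (`≤ d⌊(L−1)∕2⌋·M`), `abs_segSum_le`∕`abs_segMean_le` (`≤ L·M`), `abs_segIter_le`
(`≤ L^s·M`), `abs_ptMean_le`, `abs_dgrad_le`; §2 ★ `psiIter_succ_eq`, ★ `abs_psiIter_le` (`≤ d⌊(L−1)∕2⌋·(Σ_{i<s}L^i)·M`), `abs_psiIter_le'` (`≤ (d∕2)·L^s·M`), ★★ `abs_linAvgIter_le`
(`≤ (d+1)·L^s·M`), `abs_linAvg04_le` (`≤ (d+1)·L·M`); §3 `abs_S0_le` (`≤ 18^d·M`), ★ `abs_S1_le` (`≤ 18^d·M∕L^k`) by the per-coordinate method of `abs_S2_le`.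
HONEST FRAMING.  Lattice bookkeeping; count-neutral helper toward R3 2′ (items 19936∕19935); registry untouched; (FL) NOT proved here; nothing about d = 4, the continuum, or a mass
gap; YM₃ on T³ is rung R3, not Clay.

References: T. Bałaban, Commun. Math. Phys. 109 (1987) 249–301 [Balaban1987RG1] ((0.3)–(0.4), (0.11) pp.252–253); CMP 98 (1985) 17–51 [Balaban1985Averaging] ((14) p.19, (125) p.36).
-/

set_option autoImplicit false

noncomputable section

namespace Summit.QuantumFields.YangMills.Theorems.LinearAvgSup

open Finset
open Literature.MathematicalPhysics.QuantumFieldTheory.Balaban1983to89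
open Literature.MathematicalPhysics.QuantumFieldTheory.Balaban1983to89.T4Continuum
open Literature.MathematicalPhysics.QuantumFieldTheory.Balaban1983to89.BlockAveraging (off Idx off_bounds)
open Literature.MathematicalPhysics.QuantumFieldTheory.Balaban1983to89.LatticeWordStokes (length_stairWord_le)
open Summit.QuantumFields.YangMills.Theorems.AbelianEML (wsum wsum_nil wsum_cons_true wsum_cons_false stairSum segSum stairMean segMean offPt linAvgIter linAvg04)
open Summit.QuantumFields.YangMills.Theorems.LinearLiftGauge (dgrad ptMean segOp segIter psiIter linAvgIter_eq_segIter_sub stairMean_dgrad stairMean_sub)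
open Summit.QuantumFields.YangMills.Theorems.LinearLiftProfile
open Summit.QuantumFields.YangMills.Theorems.LinearLiftSpread (hh hside S0 S1 sum_abs_PS_le)

variable {P : Params} {j : ℕ}

/-! ## §1 Walk sums, staircase and segment means, the iterated segment mean -/

/-- **`|wsum a x w| ≤ |w|·M`** when `|a_b| ≤ M` for every bond. [cite: Balaban1985Averaging, (9) p.18 (bookkeeping)] -/
theorem abs_wsum_le (a : PBond P j → ℝ) {M : ℝ} (hM : ∀ b, |a b| ≤ M) :
    ∀ (w : List (Letter P.d)) (x : Site P j), |wsum a x w| ≤ (w.length : ℝ) * M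
  | [], x => by simp
  | (μ, true) :: w, x => by
    rw [wsum_cons_true, List.length_cons]
    push_cast
    calc |a ⟨x, μ⟩ + wsum a (x.shift μ) w| ≤ |a ⟨x, μ⟩| + |wsum a (x.shift μ) w| := abs_add_le _ _
      _ ≤ M + (w.length : ℝ) * M := add_le_add (hM _) (abs_wsum_le a hM w _)
      _ = ((w.length : ℝ) + 1) * M := by ring
  | (μ, false) :: w, x => by
    rw [wsum_cons_false, List.length_cons]
    push_cast
    calc |-a ⟨x.unshift μ, μ⟩ + wsum a (x.unshift μ) w| ≤ |-a ⟨x.unshift μ, μ⟩| + |wsum a (x.unshift μ) w| := abs_add_le _ _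
      _ ≤ M + (w.length : ℝ) * M := add_le_add (by rw [abs_neg]; exact hM _) (abs_wsum_le a hM w _)
      _ = ((w.length : ℝ) + 1) * M := by ring

/-- A mean of reals bounded by `B` in absolute value is bounded by `B`. [folklore] -/
theorem abs_mean_le {ι : Type*} [Fintype ι] [Nonempty ι] (f : ι → ℝ) {B : ℝ} (h : ∀ i, |f i| ≤ B) :
    |(Fintype.card ι : ℝ)⁻¹ * ∑ i, f i| ≤ B := by
  have hc : (0 : ℝ) < Fintype.card ι := Nat.cast_pos.mpr Fintype.card_pos
  rw [abs_mul, abs_inv, abs_of_pos hc, inv_mul_le_iff₀ hc]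
  calc |∑ i, f i| ≤ ∑ i, |f i| := abs_sum_le_sum_abs _ _
    _ ≤ ∑ _i : ι, B := sum_le_sum fun i _ => h i
    _ = (Fintype.card ι : ℝ) * B := by rw [sum_const, card_univ, nsmul_eq_mul]

/-- **`|stairSum a y n σ| ≤ d·N·M`** when `|n_ν| ≤ N` and `|a_b| ≤ M`. [cite: Balaban1987RG1, (0.3) p.252 (bookkeeping)] -/
theorem abs_stairSum_le (a : PBond P j → ℝ) {M : ℝ} (hM : ∀ b, |a b| ≤ M) (y : Site P (j + 1)) (n : Fin P.d → ℤ)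
    (σ : Equiv.Perm (Fin P.d)) {N : ℕ} (hn : ∀ ν, (n ν).natAbs ≤ N) :
    |stairSum a y n σ| ≤ ((P.d * N : ℕ) : ℝ) * M := by
  have hM0 : 0 ≤ M := (abs_nonneg _).trans (hM ⟨emb y, ⟨0, P.hd⟩⟩)
  unfold stairSum
  refine (abs_wsum_le a hM _ _).trans (mul_le_mul_of_nonneg_right ?_ hM0)
  exact_mod_cast length_stairWord_le σ n N hn

/-- The (0.3) offsets satisfy `|off r ν| ≤ ⌊(L−1)∕2⌋`. [cite: Balaban1987RG1, (0.3) p.252] -/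
theorem natAbs_off_le (r : Fin P.d → Fin P.L) (ν : Fin P.d) : (off r ν).natAbs ≤ (P.L - 1) / 2 := by
  have h := off_bounds r ν
  omega

/-- **`|stairMean a y| ≤ d·⌊(L−1)∕2⌋·M`**. [cite: Balaban1987RG1, (0.3)–(0.4) p.252] -/
theorem abs_stairMean_le (a : PBond P j → ℝ) {M : ℝ} (hM : ∀ b, |a b| ≤ M) (y : Site P (j + 1)) :
    |stairMean a y| ≤ ((P.d * ((P.L - 1) / 2) : ℕ) : ℝ) * M := by
  unfold stairMean
  exact abs_mean_le _ fun i => abs_stairSum_le a hM y (off i.1) i.2.1 fun ν => natAbs_off_le i.1 ν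

/-- **`|segSum a y n μ| ≤ L·M`**. [cite: Balaban1987RG1, (0.4) p.253 (bookkeeping)] -/
theorem abs_segSum_le (a : PBond P j → ℝ) {M : ℝ} (hM : ∀ b, |a b| ≤ M) (y : Site P (j + 1)) (n : Fin P.d → ℤ) (μ : Fin P.d) :
    |segSum a y n μ| ≤ (P.L : ℝ) * M := by
  unfold segSum
  have h := abs_wsum_le a hM (List.replicate P.L (μ, true)) (offPt y n)
  rwa [List.length_replicate] at h

/-- **`|segMean a c| ≤ L·M`**. [cite: Balaban1987RG1, (0.4) p.253 (bookkeeping)] -/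
theorem abs_segMean_le (a : PBond P j → ℝ) {M : ℝ} (hM : ∀ b, |a b| ≤ M) (c : PBond P (j + 1)) :
    |segMean a c| ≤ (P.L : ℝ) * M := by
  unfold segMean
  exact abs_mean_le _ fun i => abs_segSum_le a hM c.src (off i.1) c.dir

/-- **`|M^s a| ≤ L^s·M`** — the iterated segment mean grows exactly like the segment length. [cite: Balaban1987RG1, (0.11) p.253] -/
theorem abs_segIter_le (a : PBond P 0 → ℝ) {M : ℝ} (hM : ∀ b, |a b| ≤ M) :
    ∀ (s : ℕ) (c : PBond P s), |segIter s a c| ≤ (P.L : ℝ) ^ s * M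
  | 0, c => by simpa [segIter] using hM c
  | s + 1, c => by
    show |segMean (segIter s a) c| ≤ _
    rw [pow_succ, mul_comm ((P.L : ℝ) ^ s), mul_assoc]
    exact abs_segMean_le _ (fun b => abs_segIter_le a hM s b) c

/-- **`|ptMean g y| ≤ B`** when `|g| ≤ B`. [folklore] -/
theorem abs_ptMean_le (g : Site P j → ℝ) {B : ℝ} (h : ∀ x, |g x| ≤ B) (y : Site P (j + 1)) : |ptMean g y| ≤ B := by
  unfold ptMean
  exact abs_mean_le _ fun i => h _

/-- **`|dgrad g b| ≤ 2B`** when `|g| ≤ B`. [folklore] -/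
theorem abs_dgrad_le (g : Site P j → ℝ) {B : ℝ} (h : ∀ x, |g x| ≤ B) (b : PBond P j) : |dgrad g b| ≤ 2 * B := by
  unfold dgrad
  calc |g b.tgt - g b.src| ≤ |g b.tgt| + |g b.src| := abs_sub _ _
    _ ≤ B + B := add_le_add (h _) (h _)
    _ = 2 * B := by ring

/-! ## §2 The telescoped coboundary potential and the `k`-uniform bound on `linAvgIter` -/

/-- **★ THE COBOUNDARY POTENTIAL, TELESCOPED**: `Ψ_{s+1}(y) = Ψ_s(emb y) + Φ(M^s a)(y)` — in `Ψ_{s+1} = ptMean Ψ_s + Φ(Q₁^s a)` the staircase mean of `Q₁^s a = M^s a − dΨ_s` contributes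
`−(ptMean Ψ_s − Ψ_s∘emb)` (`stairMean_dgrad`), cancelling the point mean exactly. [cite: Balaban1987RG1, (0.4)+(0.11) p.253] -/
theorem psiIter_succ_eq (a : PBond P 0 → ℝ) (s : ℕ) (y : Site P (s + 1)) :
    psiIter (s + 1) a y = psiIter s a (emb y) + stairMean (segIter s a) y := by
  show ptMean (psiIter s a) y + stairMean (linAvgIter s a) y = _
  rw [linAvgIter_eq_segIter_sub, stairMean_sub, stairMean_dgrad]
  ring

/-- **★ `|Ψ_s(a)| ≤ d⌊(L−1)∕2⌋·(Σ_{i<s} L^i)·M`** — geometric, by §2's telescoped recursion and `|Φ(M^i a)| ≤ d⌊(L−1)∕2⌋·L^i·M`. [cite: Balaban1987RG1, (0.4)+(0.11) p.253] -/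
theorem abs_psiIter_le (a : PBond P 0 → ℝ) {M : ℝ} (hM : ∀ b, |a b| ≤ M) :
    ∀ (s : ℕ) (y : Site P s), |psiIter s a y| ≤ ((P.d * ((P.L - 1) / 2) : ℕ) : ℝ) * ((∑ i ∈ range s, (P.L : ℝ) ^ i) * M)
  | 0, y => by simp [psiIter]
  | s + 1, y => by
    rw [psiIter_succ_eq, sum_range_succ, add_mul, mul_add]
    refine (abs_add_le _ _).trans (add_le_add (abs_psiIter_le a hM s _) ?_)
    exact abs_stairMean_le _ (fun b => abs_segIter_le a hM s b) y

/-- `⌊(L−1)∕2⌋ = (L−1)∕2` in `ℝ` (`L` odd). [cite: Balaban1987RG1, (0.1) p.251] -/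
theorem cast_half_eq : ((((P.L - 1) / 2 : ℕ)) : ℝ) = ((P.L : ℝ) - 1) / 2 := by
  have h := AveragingRT.two_mul_half_add_one P
  have h' : (2 : ℝ) * ((((P.L - 1) / 2 : ℕ)) : ℝ) + 1 = P.L := by exact_mod_cast h
  linarith

/-- **`|Ψ_s(a)| ≤ (d∕2)·(L^s − 1)·M ≤ (d∕2)·L^s·M`** (`(L−1)·Σ_{i<s}L^i = L^s − 1`). [cite: Balaban1987RG1, (0.4)+(0.11) p.253] -/
theorem abs_psiIter_le' (a : PBond P 0 → ℝ) {M : ℝ} (hM : ∀ b, |a b| ≤ M) (s : ℕ) (y : Site P s) :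
    |psiIter s a y| ≤ (P.d : ℝ) / 2 * ((P.L : ℝ) ^ s - 1) * M := by
  have h := abs_psiIter_le a hM s y
  have hgeom : (∑ i ∈ range s, (P.L : ℝ) ^ i) * ((P.L : ℝ) - 1) = (P.L : ℝ) ^ s - 1 := geom_sum_mul _ _
  have e : ((P.d * ((P.L - 1) / 2) : ℕ) : ℝ) * ((∑ i ∈ range s, (P.L : ℝ) ^ i) * M) = (P.d : ℝ) / 2 * ((P.L : ℝ) ^ s - 1) * M := by
    push_cast
    rw [cast_half_eq, ← hgeom]
    ring
  rwa [e] at h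

/-- **★★ THE ITERATED (0.4)-LINEAR AVERAGE IS BOUNDED UNIFORMLY IN THE NUMBER OF STEPS**: `|linAvgIter s a (c)| ≤ (d+1)·L^s·M` when `|a_b| ≤ M` — `Q₁^s a = M^s a − dΨ_s(a)` with
`|M^s a| ≤ L^s M` and `|Ψ_s(a)| ≤ (d∕2)L^s M`.  (The one-step crude bound iterated would give `((d+2)L)^s`.) [cite: Balaban1987RG1, (0.4)+(0.11) p.253] -/
theorem abs_linAvgIter_le (a : PBond P 0 → ℝ) {M : ℝ} (hM : ∀ b, |a b| ≤ M) (s : ℕ) (c : PBond P s) :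
    |linAvgIter s a c| ≤ ((P.d : ℝ) + 1) * (P.L : ℝ) ^ s * M := by
  rw [linAvgIter_eq_segIter_sub]
  simp only [Pi.sub_apply]
  have h1 := abs_segIter_le a hM s c
  have h2 : |dgrad (psiIter s a) c| ≤ 2 * ((P.d : ℝ) / 2 * ((P.L : ℝ) ^ s - 1) * M) := abs_dgrad_le _ (fun y => abs_psiIter_le' a hM s y) c
  have hd : (0 : ℝ) ≤ P.d := Nat.cast_nonneg _
  calc |segIter s a c - dgrad (psiIter s a) c| ≤ |segIter s a c| + |dgrad (psiIter s a) c| := abs_sub _ _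
    _ ≤ (P.L : ℝ) ^ s * M + 2 * ((P.d : ℝ) / 2 * ((P.L : ℝ) ^ s - 1) * M) := add_le_add h1 h2
    _ = ((P.d : ℝ) + 1) * (P.L : ℝ) ^ s * M - (P.d : ℝ) * M := by ring
    _ ≤ ((P.d : ℝ) + 1) * (P.L : ℝ) ^ s * M := by
        have hM0 : 0 ≤ M := (abs_nonneg _).trans (hM ⟨fun _ => 0, c.dir⟩)
        nlinarith

/-- **`|linAvg04 a (c)| ≤ (d+1)·L·M`** (the case `s = 1`). [cite: Balaban1987RG1, (0.4) p.253] -/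
theorem abs_linAvg04_le (a : PBond P 0 → ℝ) {M : ℝ} (hM : ∀ b, |a b| ≤ M) (c : PBond P 1) :
    |linAvg04 a c| ≤ ((P.d : ℝ) + 1) * (P.L : ℝ) * M := by
  have h := abs_linAvgIter_le a hM 1 c
  rwa [pow_one] at h

/-! ## §3 Sup bounds of the spreads `S0`, `S1` -/

/-- **`|S0 k λ (x)| ≤ 18^d·M`** when `|λ| ≤ M` (per coordinate `Σ_c |Pσ(x_i, c)| ≤ 18`). [folklore] -/
theorem abs_S0_le (k : ℕ) (lam : Site P k → ℝ) {M : ℝ} (hM : ∀ y, |lam y| ≤ M) (x : Site P 0) :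
    |S0 k lam x| ≤ (18 : ℝ) ^ P.d * M := by
  have hM0 : 0 ≤ M := (abs_nonneg _).trans (hM (fun _ => 0))
  have hsum : ∀ i : Fin P.d, ∑ c : ZMod (P.sitesPerDir k), |Psig (hh P k) (x i) c| ≤ 18 := by
    intro i
    have := sum_abs_PS_le (Nk := P.sitesPerDir k) (hh P k) (sigma (hh P k)) (abs_sigma_le (hh P k)) (qIdx (hh P k) (x i) : ℤ) (tOff (hh P k) (x i))
    unfold Psig
    linarith
  calc |S0 k lam x| = |∑ y : Site P k, lam y * ∏ i, Psig (hh P k) (x i) (y i)| := rfl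
    _ ≤ ∑ y : Site P k, |lam y * ∏ i, Psig (hh P k) (x i) (y i)| := abs_sum_le_sum_abs _ _
    _ ≤ ∑ y : Site P k, M * ∏ i, |Psig (hh P k) (x i) (y i)| := by
        refine sum_le_sum fun y _ => ?_
        rw [abs_mul, abs_prod]
        exact mul_le_mul_of_nonneg_right (hM y) (prod_nonneg fun i _ => abs_nonneg _)
    _ = M * ∏ i, ∑ c : ZMod (P.sitesPerDir k), |Psig (hh P k) (x i) c| := by
        rw [← mul_sum, Finset.prod_univ_sum]
        rfl
    _ ≤ M * ∏ _i : Fin P.d, (18 : ℝ) := by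
        refine mul_le_mul_of_nonneg_left ?_ hM0
        exact prod_le_prod (fun i _ => sum_nonneg fun c _ => abs_nonneg _) fun i _ => hsum i
    _ = (18 : ℝ) ^ P.d * M := by rw [prod_const, card_univ, Fintype.card_fin]; ring

/-- **★ `|S1 k A (b)| ≤ 18^d·M∕L^k`** when `|A| ≤ M`: the bond direction carries `Pτ` (`Σ_c|Pτ(x_μ, c)| ≤ 18∕L^k`), the others `Pσ` (`≤ 18` each) — the spread of a coarse one-form
is `L^{−k}`-small bond by bond, as a potential at scale `L^k` must be. [cite: Balaban1985Averaging, (125) p.36 (bookkeeping)] -/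
theorem abs_S1_le (k : ℕ) (A : PBond P k → ℝ) {M : ℝ} (hM : ∀ c, |A c| ≤ M) (b : PBond P 0) :
    |S1 k A b| ≤ (18 : ℝ) ^ P.d * M / (P.L : ℝ) ^ k := by
  have hM0 : 0 ≤ M := (abs_nonneg _).trans (hM ⟨fun _ => 0, b.dir⟩)
  have hn : (0 : ℝ) < side (hh P k) := side_real_pos _
  -- the weight of `y` as a product over ALL coordinates of per-coordinate factors
  let w : Fin P.d → ZMod (P.sitesPerDir 0) → ZMod (P.sitesPerDir k) → ℝ := fun i a c =>
    if i = b.dir then Ptau (hh P k) a c else Psig (hh P k) a c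
  have hw : ∀ y : Site P k, Ptau (hh P k) (b.src b.dir) (y b.dir) * ∏ i ∈ univ.erase b.dir, Psig (hh P k) (b.src i) (y i)
      = ∏ i, w i (b.src i) (y i) := by
    intro y
    rw [← mul_prod_erase univ (fun i => w i (b.src i) (y i)) (mem_univ b.dir)]
    simp only [w, if_pos rfl]
    congr 1
    exact prod_congr rfl fun i hi => by rw [if_neg (ne_of_mem_erase hi)]
  have hsum : ∀ i, ∑ c : ZMod (P.sitesPerDir k), |w i (b.src i) c| ≤ if i = b.dir then (18 : ℝ) / (side (hh P k) : ℝ) else (18 : ℝ) := by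
    intro i
    by_cases h : i = b.dir
    · simp only [w, if_pos h]
      have := sum_abs_PS_le (Nk := P.sitesPerDir k) (hh P k) (tau (hh P k)) (abs_tau_le (hh P k)) (qIdx (hh P k) (b.src i) : ℤ) (tOff (hh P k) (b.src i))
      unfold Ptau
      calc _ ≤ 3 * (6 / (side (hh P k) : ℝ)) := this
        _ = 18 / side (hh P k) := by ring
    · simp only [w, if_neg h]
      have := sum_abs_PS_le (Nk := P.sitesPerDir k) (hh P k) (sigma (hh P k)) (abs_sigma_le (hh P k)) (qIdx (hh P k) (b.src i) : ℤ) (tOff (hh P k) (b.src i))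
      unfold Psig
      linarith
  calc |S1 k A b| = |∑ y : Site P k, A ⟨y, b.dir⟩ * ∏ i, w i (b.src i) (y i)| := by
        unfold S1; exact congrArg _ (sum_congr rfl fun y _ => by rw [hw])
    _ ≤ ∑ y : Site P k, |A ⟨y, b.dir⟩ * ∏ i, w i (b.src i) (y i)| := abs_sum_le_sum_abs _ _
    _ ≤ ∑ y : Site P k, M * ∏ i, |w i (b.src i) (y i)| := by
        refine sum_le_sum fun y _ => ?_
        rw [abs_mul, abs_prod]
        exact mul_le_mul_of_nonneg_right (hM _) (prod_nonneg fun i _ => abs_nonneg _)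
    _ = M * ∏ i, ∑ c : ZMod (P.sitesPerDir k), |w i (b.src i) c| := by
        rw [← mul_sum, Finset.prod_univ_sum]
        rfl
    _ ≤ M * ∏ i, (if i = b.dir then (18 : ℝ) / (side (hh P k) : ℝ) else (18 : ℝ)) := by
        refine mul_le_mul_of_nonneg_left ?_ hM0
        exact prod_le_prod (fun i _ => sum_nonneg fun c _ => abs_nonneg _) fun i _ => hsum i
    _ = M * ((18 : ℝ) ^ P.d / (side (hh P k) : ℝ)) := by
        congr 1
        rw [← mul_prod_erase univ _ (mem_univ b.dir), if_pos rfl]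
        have hrest : ∏ i ∈ univ.erase b.dir, (if i = b.dir then (18 : ℝ) / (side (hh P k) : ℝ) else (18 : ℝ)) = (18 : ℝ) ^ (univ.erase b.dir).card := by
          rw [← prod_const]
          exact prod_congr rfl fun i hi => by rw [if_neg (ne_of_mem_erase hi)]
        rw [hrest, card_erase_of_mem (mem_univ b.dir), card_univ, Fintype.card_fin]
        have e : (18 : ℝ) ^ P.d = 18 * (18 : ℝ) ^ (P.d - 1) := by
          rw [← pow_succ']; congr 1; have := P.hd; omega
        rw [e]; field_simp
    _ = (18 : ℝ) ^ P.d * M / (P.L : ℝ) ^ k := by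
        rw [show (side (hh P k) : ℝ) = (P.L : ℝ) ^ k by rw [hside]; push_cast; ring]; ring

end Summit.QuantumFields.YangMills.Theorems.LinearAvgSup

end
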